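import Mathlib
import Literature.NumberTheory.LFunctions.Zhang2022.AppendixALocalSeries
import Literature.NumberTheory.LFunctions.Zhang2022.TypedAppendixA2
import Literature.NumberTheory.LFunctions.Zhang2022.TypedSection01and02B
import HarnessLib

/-!
# Zhang (2022), Appendix A part 2 (iii): the typed steps of the proof of Lemma 15.2 DISCHARGED

Topic `Literature/NumberTheory/LFunctions/Zhang2022` (Landau–Siegel audit tree; verdict-neutral).
Y. Zhang, *Discrete mean estimates and the Landau–Siegel zero*, arXiv:2211.02515v1 (2022)
[Zhang2022LandauSiegel] — **an unrefereed manuscript under adjudication**. The cell's typed statement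
file `TypedAppendixA2` (namespace `…Zhang2022.Typed.AppendixA2`) states every display of the proof of
Lemma 15.2 (App. A pp. 103–104) as a `Prop` (CLAIM, stated not asserted); this file PROVES those claims
from the per-prime kit `AppendixALocalFactors` / `AppendixALocalSeries`, with explicit constants and
explicit thresholds `D ≥ D₀(c′)` — so the corresponding DAG nodes of the cell's campaign are
DISCHARGED (kernel-checked), not merely typed:

* `stepA_u023_holds : StepA_u023 c'` — `κ₁(qʳ) = 1 + O(αr log q)` (constant `4`, i.e.
  `|κ₁(qʳ) − 1| ≤ 4αr log q` once `7π|c′| ≤ 𝓛⁸`; the printed restriction `qʳ < P` is not used);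
* `stepA_u024b_holds : StepA_u024b c'` — the middle relation of
  `κ̃₁(qʳ,1) = Σ_{h∈𝔫(q)} κ₁(qʳh)χ(h)/h = Σ_{h∈𝔫(q)} χ(h)/h + O(αr log q) = 1/(1−vu) + O(αr log q)`
  (constant `16`; the two EXACT outer relations are proved in `TypedAppendixA2` itself);
* `stepA_u026_holds : StepA_u026 c'` — `λ₁(q) = 1 − vu + O(α log q/q)` (constant `16`).

The EXACT leaves u021a, u022, u024a, u024c, u028, u029 are kernel-checked inside `TypedAppendixA2`
(`Typed.AppendixA2.stepA_u022_holds`, …); the `s`-dependent steps u021b, u025, u027 and (A.6)/(A.7)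
are the companion file's (`AppendixALemma152StepsS.lean`). Hypothesis (A) is never used (the typed
claims carry it as an antecedent, which is simply discarded).

## References

* Y. Zhang, arXiv:2211.02515v1 (2022), Appendix A pp. 103–104 (proof of Lemma 15.2); (2.13) p. 5.
  [cite: Zhang2022LandauSiegel, Appendix A]
-/

noncomputable section

open Finset Real Complex ArithmeticFunction

namespace Literature.NumberTheory.LFunctions.Zhang2022.AppendixALocal

open MeanSquareMajorant (powI kappa₁)
open Skeleton (ell alpha bigP b1 b2 beta1 beta2 nset ForAllLarge)
-- OBJECTS: since L4-t9's merge revision (p414212) the §15 objects of `Typed.AppendixA2` are the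
-- imported `Typed.Section15A.{kappa1, kappaTilde1, lam1}`.
open Typed.Section15A (kappa1 kappaTilde1 lam1)

/-! ### §1. Thresholds: `𝓛`, `α`, `b₁`, `b₂` -/

/-- `𝓛 ≥ M` once `D ≥ ⌈e^M⌉ + 1`. [cite: Zhang2022LandauSiegel, §2 (2.1)] -/
theorem le_ell_of_le {M : ℝ} {D : ℕ} (hD : ⌈Real.exp M⌉₊ + 1 ≤ D) : M ≤ ell D := by
  have hD' : Real.exp M ≤ D := by
    have h1 : (⌈Real.exp M⌉₊ : ℝ) + 1 ≤ D := by exact_mod_cast hD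
    linarith [Nat.le_ceil (Real.exp M)]
  rw [ell]
  calc M = Real.log (Real.exp M) := (Real.log_exp M).symm
    _ ≤ Real.log D := Real.log_le_log (Real.exp_pos M) hD'

/-- `q^{−β₁} = powI b₁ q` (`q ≥ 1`). [cite: Zhang2022LandauSiegel, §2 (2.13)] -/
theorem cpow_neg_beta1 (c' : ℝ) (D : ℕ) {q : ℕ} (hq : q ≠ 0) :
    (q : ℂ) ^ (-beta1 c' D) = powI (b1 c' D) q := by
  rw [MeanSquareMajorant.powI_apply_of_ne_zero _ hq, Typed.Section16A.beta1_eq_b1_mul_I]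

/-- `q^{−β₂} = powI b₂ q` (`q ≥ 1`). [cite: Zhang2022LandauSiegel, §2 (2.13)] -/
theorem cpow_neg_beta2 (c' : ℝ) (D : ℕ) {q : ℕ} (hq : q ≠ 0) :
    (q : ℂ) ^ (-beta2 c' D) = powI (b2 c' D) q := by
  rw [MeanSquareMajorant.powI_apply_of_ne_zero _ hq, Typed.Section16A.beta2_eq_b2_mul_I]

/-- **`|b₁| + |b₂| ≤ 4α` once `7π|c′| ≤ 𝓛⁸`** (then `|c′|α𝓛 = |c′|π/𝓛⁸ ≤ 1/7`, so
`|b₁| ≤ (12/7)α`, `|b₂| ≤ (16/7)α`). [cite: Zhang2022LandauSiegel, §2 (2.13)] -/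
theorem abs_b1_add_abs_b2_le (c' : ℝ) {D : ℕ} (hℓ : 1 ≤ ell D) (hc : 7 * π * |c'| ≤ ell D ^ 8) :
    |b1 c' D| + |b2 c' D| ≤ 4 * alpha D := by
  have hℓ0 : 0 < ell D := by linarith
  have hα : alpha D = π / ell D ^ 9 := Section2.alpha_eq_pi_div_ell9 D
  have hα0 : 0 < alpha D := by rw [hα]; positivity
  have hαℓ : alpha D * ell D = π / ell D ^ 8 := by
    rw [hα]; field_simp
  have hkey : |c'| * (alpha D * ell D) ≤ 1 / 7 := by
    rw [hαℓ]
    have h8 : 0 < ell D ^ 8 := by positivity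
    rw [mul_div_assoc', div_le_iff₀ h8]
    nlinarith
  have h1 : |b1 c' D| ≤ alpha D * (1 + 5 * (1 / 7)) := by
    rw [b1, abs_mul, abs_of_pos hα0]
    gcongr
    calc |1 - 5 * c' * alpha D * ell D| ≤ |(1 : ℝ)| + |5 * c' * alpha D * ell D| := abs_sub _ _
      _ = 1 + 5 * (|c'| * (alpha D * ell D)) := by
          rw [abs_one, show 5 * c' * alpha D * ell D = 5 * (c' * (alpha D * ell D)) by ring,
            abs_mul, abs_mul, abs_of_pos (by norm_num : (0:ℝ) < 5),
            abs_of_pos (mul_pos hα0 hℓ0)]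
      _ ≤ 1 + 5 * (1 / 7) := by gcongr
  have h2 : |b2 c' D| ≤ 2 * alpha D * (1 + 1 / 7) := by
    rw [b2, abs_mul, abs_mul, abs_of_pos hα0, abs_of_pos (by norm_num : (0:ℝ) < 2)]
    gcongr
    calc |1 + c' * alpha D * ell D| ≤ |(1 : ℝ)| + |c' * alpha D * ell D| := abs_add_le _ _
      _ = 1 + |c'| * (alpha D * ell D) := by
          rw [abs_one, show c' * alpha D * ell D = c' * (alpha D * ell D) by ring, abs_mul,
            abs_of_pos (mul_pos hα0 hℓ0)]
      _ ≤ 1 + 1 / 7 := by gcongr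
  nlinarith

/-- The threshold of these files: `D₀(c′) = ⌈exp(7π|c′| + 32)⌉ + 1`; for `D ≥ D₀`: `𝓛 ≥ 32`,
`7π|c′| ≤ 𝓛 ≤ 𝓛⁸`, hence `|b₁|+|b₂| ≤ 4α`, and `200α𝓛 ≤ 1` (`α𝓛 = π/𝓛⁸`). [cite: Zhang2022LandauSiegel, §2 p. 4] -/
theorem threshold (c' : ℝ) {D : ℕ} (hD : ⌈Real.exp (7 * π * |c'| + 32)⌉₊ + 1 ≤ D) :
    32 ≤ ell D ∧ |b1 c' D| + |b2 c' D| ≤ 4 * alpha D ∧ 200 * alpha D * ell D ≤ 1 ∧ 0 < alpha D := by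
  have hM := le_ell_of_le hD
  have hc0 : 0 ≤ 7 * π * |c'| := by positivity
  have hℓ : 32 ≤ ell D := by linarith
  have hℓ1 : 1 ≤ ell D := by linarith
  have h8 : ell D ≤ ell D ^ 8 := by
    calc ell D = ell D ^ 1 := (pow_one _).symm
      _ ≤ ell D ^ 8 := pow_le_pow_right₀ hℓ1 (by norm_num)
  have hc : 7 * π * |c'| ≤ ell D ^ 8 := by linarith
  have hα : alpha D = π / ell D ^ 9 := Section2.alpha_eq_pi_div_ell9 D
  have hα0 : 0 < alpha D := by rw [hα]; positivity
  refine ⟨hℓ, abs_b1_add_abs_b2_le c' hℓ1 hc, ?_, hα0⟩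
  rw [hα]
  have h9 : 0 < ell D ^ 9 := by positivity
  have hπ : π ≤ 4 := Real.pi_le_four
  have h3 : ell D ^ 3 ≤ ell D ^ 9 := pow_le_pow_right₀ hℓ1 (by norm_num)
  have h3' : (32 : ℝ) * 32 * ell D ≤ ell D ^ 3 := by
    have : ell D ^ 3 = ell D * ell D * ell D := by ring
    rw [this]
    have h0 : 0 ≤ ell D := by linarith
    nlinarith [mul_le_mul hℓ hℓ (by norm_num) h0]
  have key : 200 * π * ell D ≤ ell D ^ 9 := by nlinarith
  calc 200 * (π / ell D ^ 9) * ell D = (200 * π * ell D) / ell D ^ 9 := by ring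
    _ ≤ 1 := by rw [div_le_one h9]; exact key

/-! ### §2. `Z22:§A.u023` -/

/-- **`Z22:§A.u023` DISCHARGED**: `|κ₁(qʳ) − 1| ≤ 4αr log q` for every prime `q` and `r ≥ 1`, for all
`D ≥ D₀(c′)` (the printed hypotheses `q < D`, `qʳ < P` and (A) are not needed).
[cite: Zhang2022LandauSiegel, App. A p. 104 (proof of Lemma 15.2)] -/
theorem stepA_u023_holds (c' : ℝ) : Typed.AppendixA2.StepA_u023 c' := by
  refine ⟨4, ForAllLarge.of_le (⌈Real.exp (7 * π * |c'| + 32)⌉₊ + 1) ?_⟩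
  intro D _ χ hD _ _ _ q r hq _ _ _
  obtain ⟨-, hb, -, hα0⟩ := threshold c' hD
  have hlog : 0 ≤ Real.log q := Real.log_natCast_nonneg q
  calc ‖kappa1 c' D (q ^ r) - 1‖ ≤ r * ((|b1 c' D| + |b2 c' D|) * Real.log q) :=
        norm_kappa₁_prime_pow_sub_one_le _ _ hq r
    _ ≤ r * ((4 * alpha D) * Real.log q) := by gcongr
    _ = 4 * (alpha D * r * Real.log q) := by ring

variable (c' : ℝ) in
/-- `StepA_u023` — `_holds` alias of `stepA_u023_holds` above under the fact's exact name, stated under the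
prover's own binders as section variables (appended 2026-08-28, D-0026 bookkeeping: the proof term is the
existing theorem of this file; no statement, definition or attribute is edited; no new named fact; the
ledger's debt table listed the fact unproved). [cite: Zhang2022LandauSiegel, App. A p. 104 (proof of Lemma 15.2)] -/
theorem _root_.Literature.NumberTheory.LFunctions.Zhang2022.Typed.AppendixA2.StepA_u023_holds :
    _root_.Literature.NumberTheory.LFunctions.Zhang2022.Typed.AppendixA2.StepA_u023 c' :=
  _root_.Literature.NumberTheory.LFunctions.Zhang2022.AppendixALocal.stepA_u023_holds (c' := c')

/-! ### §3. `Z22:§A.u024` (middle relation) -/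

/-- Reindexing over `𝔫(qʳ)` without a coprimality condition: `Σ_{h∈𝔫(qʳ)} f(h) = Σ_k f(qᵏ)`.
[cite: Zhang2022LandauSiegel, App. A p. 104 (proof of Lemma 15.2)] -/
theorem tsum_nset_prime_pow' {q r : ℕ} (hq : q.Prime) (hr : r ≠ 0) (f : ℕ → ℂ)
    [∀ h, Decidable (h ∈ nset (q ^ r))] :
    ∑' h : ℕ, (if h ∈ nset (q ^ r) then f h else 0) = ∑' k : ℕ, f (q ^ k) := by
  classical
  have h := tsum_nset_prime_pow_of_coprime hq hr (m := 1) (Nat.coprime_one_right q) f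
  rw [← h]
  refine tsum_congr fun n => ?_
  by_cases hn : n ∈ nset (q ^ r)
  · simp [hn]
  · simp only [hn, false_and, if_false]

/-- `χ(qᵏ) = χ(q)ᵏ` for a Dirichlet character read on `ℕ`. [cite: Zhang2022LandauSiegel, App. A p. 101 (`v = χ(q)`)] -/
theorem chi_natCast_pow {D : ℕ} (χ : DirichletCharacter ℂ D) (q k : ℕ) :
    χ ((q ^ k : ℕ) : ZMod D) = χ (q : ZMod D) ^ k := by
  rw [Nat.cast_pow, map_pow]

/-- The local form of `κ̃₁(qʳ,1)`: the typed `κ̃₁(qʳ;1,1)` IS the `k`-series `Σ_k κ₁(q^{r+k})(χ(q)q⁻¹)ᵏ`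
of `AppendixALocalSeries` (`q` prime, `r ≥ 1`). [cite: Zhang2022LandauSiegel, App. A p. 104] -/
theorem kappaTilde1_prime_pow_eq (c' : ℝ) {D : ℕ} [NeZero D] (χ : DirichletCharacter ℂ D) {q r : ℕ}
    (hq : q.Prime) (hr : 1 ≤ r) :
    kappaTilde1 c' χ (q ^ r) 1 1 =
      ∑' k : ℕ, kappa1 c' D (q ^ (r + k)) * (χ (q : ZMod D) * (q : ℂ)⁻¹) ^ k := by
  rw [kappaTilde1, tsum_nset_prime_pow_of_coprime hq (by omega) (Nat.coprime_one_right q)]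
  refine tsum_congr fun k => ?_
  rw [← pow_add, chi_natCast_pow, Complex.cpow_one, Nat.cast_pow, mul_pow, div_eq_mul_inv,
    ← inv_pow, mul_assoc]

/-- **`Z22:§A.u024`, middle relation, DISCHARGED**: `|Σ_{h∈𝔫(q)} κ₁(qʳh)χ(h)/h − Σ_{h∈𝔫(q)} χ(h)/h|
≤ 16αr log q` for all `D ≥ D₀(c′)`, every prime `q` and `r ≥ 1` (the printed `q < D`, `qʳ < P` unused).
[cite: Zhang2022LandauSiegel, App. A p. 104 (proof of Lemma 15.2)] -/
theorem stepA_u024b_holds (c' : ℝ) : Typed.AppendixA2.StepA_u024b c' := by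
  refine ⟨16, ForAllLarge.of_le (⌈Real.exp (7 * π * |c'| + 32)⌉₊ + 1) ?_⟩
  intro D _ χ hD _ _ _ q r hq _ hr _
  classical
  obtain ⟨-, hb, -, hα0⟩ := threshold c' hD
  have hv : ‖χ (q : ZMod D)‖ ≤ 1 := χ.norm_le_one _
  -- rewrite both series over `h = qᵏ`
  have h1 := tsum_nset_prime_pow' hq one_ne_zero
    (fun h => kappa1 c' D (q ^ r * h) * χ (h : ZMod D) / (h : ℂ))
  have h2 := tsum_nset_prime_pow' hq one_ne_zero (fun h => χ (h : ZMod D) / (h : ℂ))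
  rw [pow_one] at h1 h2
  rw [h1, h2]
  have e1 : ∀ k : ℕ, kappa1 c' D (q ^ r * q ^ k) * χ ((q ^ k : ℕ) : ZMod D) / ((q ^ k : ℕ) : ℂ) =
      kappa1 c' D (q ^ (r + k)) * (χ (q : ZMod D) * (q : ℂ)⁻¹) ^ k := by
    intro k
    rw [← pow_add, chi_natCast_pow, Nat.cast_pow, mul_pow, div_eq_mul_inv, ← inv_pow, mul_assoc]
  have e2 : ∀ k : ℕ, χ ((q ^ k : ℕ) : ZMod D) / ((q ^ k : ℕ) : ℂ) = (χ (q : ZMod D) * (q : ℂ)⁻¹) ^ k := by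
    intro k
    rw [chi_natCast_pow, Nat.cast_pow, div_eq_mul_inv, ← inv_pow, mul_pow]
  simp_rw [e1, e2]
  have ha : ‖χ (q : ZMod D) * (q : ℂ)⁻¹‖ < 1 :=
    lt_of_le_of_lt (norm_mul_inv_le_half hv hq.two_le) (by norm_num)
  rw [tsum_geometric_of_norm_lt_one ha]
  have hmain := norm_kappaTildeOneLocal_sub_le (b1 c' D) (b2 c' D) hv hq hr
  rw [one_div] at hmain
  have hlog : 0 ≤ Real.log q := Real.log_natCast_nonneg q
  calc ‖(∑' k : ℕ, kappa1 c' D (q ^ (r + k)) * (χ (q : ZMod D) * (q : ℂ)⁻¹) ^ k) -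
        (1 - χ (q : ZMod D) * (q : ℂ)⁻¹)⁻¹‖
      ≤ 4 * r * ((|b1 c' D| + |b2 c' D|) * Real.log q) := hmain
    _ ≤ 4 * r * ((4 * alpha D) * Real.log q) := by gcongr
    _ = 16 * (alpha D * r * Real.log q) := by ring

variable (c' : ℝ) in
/-- `StepA_u024b` — `_holds` alias of `stepA_u024b_holds` above under the fact's exact name, stated under the
prover's own binders as section variables (appended 2026-08-28, D-0026 bookkeeping: the proof term is the
existing theorem of this file; no statement, definition or attribute is edited; no new named fact; the
ledger's debt table listed the fact unproved). [cite: Zhang2022LandauSiegel, App. A p. 104 (proof of Lemma 15.2)] -/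
theorem _root_.Literature.NumberTheory.LFunctions.Zhang2022.Typed.AppendixA2.StepA_u024b_holds :
    _root_.Literature.NumberTheory.LFunctions.Zhang2022.Typed.AppendixA2.StepA_u024b c' :=
  _root_.Literature.NumberTheory.LFunctions.Zhang2022.AppendixALocal.stepA_u024b_holds (c' := c')

/-! ### §4. `Z22:§A.u026` -/

/-- The typed `λ₁(q) = λ₁(q,1)` (`lam1`) at a prime, in the variables of Appendix A:
`λ₁(q) = (1 − vux)(1 − vuy)/(1 − vu)` with `u = q⁻¹`, `v = χ(q)`, `x = powI b₁ q`, `y = powI b₂ q`.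
[cite: Zhang2022LandauSiegel, §15 (15.10) p. 82; App. A p. 104] -/
theorem lam1_prime_eq (c' : ℝ) {D : ℕ} [NeZero D] (χ : DirichletCharacter ℂ D) {q : ℕ}
    (hq : q.Prime) :
    lam1 c' χ q 1 =
      (1 - χ (q : ZMod D) * (q : ℂ)⁻¹ * powI (b1 c' D) q) *
        (1 - χ (q : ZMod D) * (q : ℂ)⁻¹ * powI (b2 c' D) q) / (1 - χ (q : ZMod D) * (q : ℂ)⁻¹) := by
  have hq0 : (q : ℂ) ≠ 0 := by exact_mod_cast hq.ne_zero
  rw [lam1, hq.primeFactors, prod_singleton, neg_add, neg_add, Complex.cpow_add _ _ hq0,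
    Complex.cpow_add _ _ hq0, Complex.cpow_neg_one, cpow_neg_beta1 c' D hq.ne_zero,
    cpow_neg_beta2 c' D hq.ne_zero, ← mul_assoc, ← mul_assoc]

/-- **`Z22:§A.u026` DISCHARGED**: `|λ₁(q) − (1 − χ(q)q⁻¹)| ≤ 16α log q/q` for all `D ≥ D₀(c′)` and
every prime `q` (the printed `q < D` unused). [cite: Zhang2022LandauSiegel, App. A p. 104 (proof of Lemma 15.2)] -/
theorem stepA_u026_holds (c' : ℝ) : Typed.AppendixA2.StepA_u026 c' := by
  refine ⟨16, ForAllLarge.of_le (⌈Real.exp (7 * π * |c'| + 32)⌉₊ + 1) ?_⟩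
  intro D _ χ hD _ _ _ q hq _
  obtain ⟨-, hb, -, hα0⟩ := threshold c' hD
  have hv : ‖χ (q : ZMod D)‖ ≤ 1 := χ.norm_le_one _
  have hu : ‖(q : ℂ)⁻¹‖ ≤ 1 / 2 := norm_inv_natCast_le_half hq.two_le
  rw [lam1_prime_eq c' χ hq]
  have h := norm_lamOneLocal_sub_le hu hv (norm_powI_le_one (b1 c' D) q) (norm_powI_le_one (b2 c' D) q)
  have hx := MeanSquareMajorant.norm_powI_sub_one_le (b1 c' D) hq.pos
  have hy := MeanSquareMajorant.norm_powI_sub_one_le (b2 c' D) hq.pos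
  have hlog : 0 ≤ Real.log q := Real.log_natCast_nonneg q
  have hq0 : (0 : ℝ) < q := by exact_mod_cast hq.pos
  calc _ ≤ 4 * ‖(q : ℂ)⁻¹‖ * (‖powI (b1 c' D) q - 1‖ + ‖powI (b2 c' D) q - 1‖) := h
    _ ≤ 4 * ‖(q : ℂ)⁻¹‖ * (|b1 c' D| * Real.log q + |b2 c' D| * Real.log q) := by gcongr
    _ = 4 * (q : ℝ)⁻¹ * ((|b1 c' D| + |b2 c' D|) * Real.log q) := by rw [norm_inv_natCast]; ring
    _ ≤ 4 * (q : ℝ)⁻¹ * ((4 * alpha D) * Real.log q) := by gcongr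
    _ = 16 * (alpha D * Real.log q / q) := by field_simp; ring

variable (c' : ℝ) in
/-- `StepA_u026` — `_holds` alias of `stepA_u026_holds` above under the fact's exact name, stated under the
prover's own binders as section variables (appended 2026-08-28, D-0026 bookkeeping: the proof term is the
existing theorem of this file; no statement, definition or attribute is edited; no new named fact; the
ledger's debt table listed the fact unproved). [cite: Zhang2022LandauSiegel, App. A p. 104 (proof of Lemma 15.2)] -/
theorem _root_.Literature.NumberTheory.LFunctions.Zhang2022.Typed.AppendixA2.StepA_u026_holds :
    _root_.Literature.NumberTheory.LFunctions.Zhang2022.Typed.AppendixA2.StepA_u026 c' :=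
  _root_.Literature.NumberTheory.LFunctions.Zhang2022.AppendixALocal.stepA_u026_holds (c' := c')

end Literature.NumberTheory.LFunctions.Zhang2022.AppendixALocal
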